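import Summits.QuantumFields.YangMills.Theorems.SwapVirialDeficitBlowUpVirialIdentity
import HarnessLib

/-!
# THE VIRIAL IDENTITY summed over the hemisphere signs and integrated over the hub (file C-prep of the V2′ assembly of fcl-p3 g45's virial SPEC,
# memo2-24197-window v2 §2′): `b·∫_cone Σ_ε ∫ XF̂·e^{−bF̂}·ρ = ∫_cone Σ_ε ∫ (N − W)·e^{−bF̂}·ρ`
# (free-hands support of ⟨stmt-QuantumFields-24197⟩ `SwapVirialDeficit.SwapGluedStiffness`)

✓`virial_fibre` ∕ ✓`virial_decomposition` (file B) hold on every chart fibre `(a, ε)` with `a ≠ 0`; the hub `a` is `coneMeasure`-distributed and `a ≠ 0` a.e.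
(✓`ZeroModeSigma.ae_ne_zero_coneMeasure`), the signs `ε : GnoSign L` are summed.  This file does that bookkeeping, in the shape of the inner integral of
w2 g57's joint gnomonic ring chart ✓∕⧗`lintegral_ringMeasure_eq_gnomonic` (`∫⁻ a, Σ_ε ∫⁻ η, … ∂coneMeasure`):
* §1 joint measurability in `(a, η)`: `measurable_gnomonicPoint_uncurry`, `measurable_gnoDeficit_uncurry`, ★ `aemeasurable_gnoXDeficit_uncurry` (`cone ⊗ vol`-a.e. limit
  of difference quotients);
* §2 the FIBRE FUNCTIONALS `a ↦ Σ_ε ∫ g_{a,ε}·e^{−bF̂_{a,ε}}·ρ dη` for `g ∈ {1, gnoW, XF̂, F̂}`: a.e.-strong measurability in `a` and integrability against `coneMeasure`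
  (bounded fibre integrals: `fibre_integral_abs_le`);
* §3 ★★ `virial_chart` (`b ≥ 0`): `b·∫ a, Σ_ε ∫ XF̂ e^{−bF̂}ρ ∂cone = ∫ a, Σ_ε ∫ (N − gnoW) e^{−bF̂}ρ ∂cone`; ★★ `virial_chart_decomposition` (`b > 0`):
  `b·∫ a, Σ_ε ∫ F̂e^{−bF̂}ρ = (N/2)·∫ a, Σ_ε ∫ e^{−bF̂}ρ − ½·∫ a, Σ_ε ∫ gnoW·e^{−bF̂}ρ + b·∫ a, Σ_ε ∫ (F̂ − ½XF̂)e^{−bF̂}ρ`, `N = 7 + 3|Fol L| = 18L⁴ − 2`.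
With the joint gnomonic ring chart these are the ring identities `b·∫F e^{−bF}dμ_L = α·Z(b) − ½·K·⟪W⟫ + b·K·⟪R⟫` (file C).
HONEST LABEL: exact fixed-`L` bookkeeping; no estimate; (V4′) uniform-in-`L` moment bounds are the OPEN input; ⟨24197⟩ (window-uniform) ∕ ⟨24194⟩ ∕ ⟨24196⟩ ∕
⟨24497⟩ OPEN; the Yang–Mills mass gap is NOT proved; no summit is proved by a line.  Seat ym-line-fcl-p3 g46 (cell ym-idea-1, free hands; item of record ⟨24085⟩
aside, untouched), `--supports stmt-QuantumFields-24197`.  THEOREMS ONLY, 0 `sorry`, standard axioms; the series' local `ℍ` instances (needed: `coneMeasure` lives on `ℍ`).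
References: [folklore] (virial ∕ Euler identity by scaling).
-/

set_option autoImplicit false
set_option synthInstance.maxSize 1024

noncomputable section

open MeasureTheory Quaternion Set Filter Topology
open scoped Quaternion BigOperators
open Literature.MathematicalPhysics.QuantumLattice
open Literature.MathematicalPhysics.QuantumFieldTheory hiding SU2
open Summit.QuantumFields.YangMills.Theorems.FemtoTransferGap
open Summit.QuantumFields.YangMills.Theorems.FemtoTransferGap.TT
open Summit.QuantumFields.YangMills.Theorems.SwapTwistDeficit.ToronLog (coneMeasure isProbabilityMeasure_coneMeasure)
open Summit.QuantumFields.YangMills.Theorems.SwapVirialDeficit.ZeroModeSigma (ae_ne_zero_coneMeasure)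

attribute [local instance] Literature.Analysis.FluidPDE.Tao2016.quatMeasurableSpace
  Literature.Analysis.FluidPDE.Tao2016.quatBorelSpace
  Literature.MathematicalPhysics.QuantumLattice.secondCountableTopology_su2

namespace Summit.QuantumFields.YangMills.Theorems.SwapVirialDeficit.BlowUpRing

variable {L : ℕ} [NeZero L]

/-! ## §1 Joint measurability in the hub and the coordinates -/

omit [NeZero L] in
/-- `(a, η) ↦ gnomonicPoint a ε η` is measurable. [folklore] -/
theorem measurable_gnomonicPoint_uncurry (ε : GnoSign L) : Measurable fun p : ℍ × GnoCoord L => gnomonicPoint (L := L) p.1 ε p.2 := by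
  refine measurable_fst.prodMk (Measurable.prodMk (Measurable.prodMk (Measurable.prodMk ?_ ?_) ?_) ?_)
  · exact (measurable_gnoLetter _).comp ((measurable_fst.comp measurable_fst).comp measurable_snd)
  · exact (measurable_gnoLetter _).comp ((measurable_snd.comp measurable_fst).comp measurable_snd)
  · exact (measurable_gnoLetter _).comp ((measurable_fst.comp measurable_snd).comp measurable_snd)
  · exact measurable_pi_lambda _ fun f =>
      (measurable_gnoLetter _).comp ((measurable_pi_apply f).comp ((measurable_snd.comp measurable_snd).comp measurable_snd))

/-- `(a, η) ↦ F̂_{a,ε}(η)` is measurable. [folklore] -/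
theorem measurable_gnoDeficit_uncurry (z : Fin 3 → Bool) (χ : Site 3 L → SU2) (ε : GnoSign L) :
    Measurable fun p : ℍ × GnoCoord L => gnoDeficit z χ p.1 ε p.2 :=
  (measurable_chartDeficit z χ).comp ((measurable_blowUpPoint 1).comp (measurable_gnomonicPoint_uncurry ε))

/-- ★ `(a, η) ↦ XF̂_{a,ε}(η)` is `cone ⊗ vol`-a.e.-measurable (a.e. limit of measurable difference quotients; `a ≠ 0` cone-a.e.). [folklore] -/
theorem aemeasurable_gnoXDeficit_uncurry (z : Fin 3 → Bool) (χ : Site 3 L → SU2) (ε : GnoSign L) :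
    AEMeasurable (fun p : ℍ × GnoCoord L => gnoXDeficit z χ p.1 ε p.2) (coneMeasure.prod (volume : Measure (GnoCoord L))) := by
  have hf : ∀ n : ℕ, Measurable fun p : ℍ × GnoCoord L =>
      ((n : ℝ) + 1) * (gnoDeficit z χ p.1 ε (eulerDilate (Real.exp (1 / ((n : ℝ) + 1))) p.2) - gnoDeficit z χ p.1 ε p.2) := fun n =>
    measurable_const.mul (((measurable_gnoDeficit_uncurry z χ ε).comp (measurable_fst.prodMk ((measurable_eulerDilate _).comp measurable_snd))).sub
      (measurable_gnoDeficit_uncurry z χ ε))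
  have hae : ∀ᵐ p : ℍ × GnoCoord L ∂(coneMeasure.prod (volume : Measure (GnoCoord L))), p.1 ≠ 0 :=
    (Measure.quasiMeasurePreserving_fst (μ := coneMeasure) (ν := (volume : Measure (GnoCoord L)))).ae ae_ne_zero_coneMeasure
  refine aemeasurable_of_tendsto_metrizable_ae (u := atTop) (fun n => (hf n).aemeasurable) ?_
  filter_upwards [hae] with p hp
  have ht := (hasDerivAt_gnoDeficit z χ hp ε p.2).1.tendsto_slope_zero
  have hu : Tendsto (fun n : ℕ => (1 : ℝ) / ((n : ℝ) + 1)) atTop (𝓝[≠] (0 : ℝ)) :=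
    tendsto_nhdsWithin_iff.2 ⟨tendsto_one_div_add_atTop_nhds_zero_nat, Eventually.of_forall fun n => ne_of_gt (by positivity)⟩
  refine (ht.comp hu).congr fun n => ?_
  simp only [Function.comp_apply, zero_add, Real.exp_zero, eulerDilate_one, one_div, inv_inv, smul_eq_mul]

/-! ## §2 The fibre functionals and their integrability against the cone measure -/

section Fibre

variable (z : Fin 3 → Bool) (χ : Site 3 L → SU2) (ε : GnoSign L) {b : ℝ}

/-- A fibre integral of a bounded integrand against `e^{−bF̂}ρ` is bounded by the bound times the mass of `ρ`. [folklore] -/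
theorem fibre_integral_abs_le {g : GnoCoord L → ℝ} {M : ℝ} (hg : ∀ η, |g η| ≤ M) (a : ℍ) (hb : 0 ≤ b) :
    |∫ η : GnoCoord L, g η * Real.exp (-(b * gnoDeficit z χ a ε η)) * gnoDensity η| ≤ M * ∫ η : GnoCoord L, gnoDensity η := by
  rw [← integral_const_mul]
  refine (abs_integral_le_integral_abs).trans (integral_mono_of_nonneg (ae_of_all _ fun η => abs_nonneg _) (integrable_gnoDensity.const_mul M)
    (ae_of_all _ fun η => ?_))
  dsimp only
  rw [abs_mul, abs_mul, abs_of_pos (gnoDensity_pos η)]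
  have h1 := abs_exp_gnoDeficit_le_one z χ a ε hb η
  have hM : 0 ≤ M := (abs_nonneg _).trans (hg η)
  calc |g η| * |Real.exp (-(b * gnoDeficit z χ a ε η))| * gnoDensity η ≤ M * 1 * gnoDensity η :=
        mul_le_mul_of_nonneg_right (mul_le_mul (hg η) h1 (abs_nonneg _) hM) (gnoDensity_pos η).le
    _ = M * gnoDensity η := by rw [mul_one]

/-- The fibre functional of a jointly measurable integrand is a.e.-strongly measurable in the hub. [folklore] -/
theorem aestronglyMeasurable_fibre {g : ℍ × GnoCoord L → ℝ} (hg : AEMeasurable g (coneMeasure.prod (volume : Measure (GnoCoord L)))) :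
    AEStronglyMeasurable (fun a : ℍ => ∫ η : GnoCoord L, g (a, η) * Real.exp (-(b * gnoDeficit z χ a ε η)) * gnoDensity η) coneMeasure := by
  have h : AEStronglyMeasurable (fun p : ℍ × GnoCoord L => g p * Real.exp (-(b * gnoDeficit z χ p.1 ε p.2)) * gnoDensity p.2)
      (coneMeasure.prod (volume : Measure (GnoCoord L))) :=
    ((hg.mul ((((measurable_gnoDeficit_uncurry z χ ε).const_mul b).neg).exp.aemeasurable)).mul
      (measurable_gnoDensity.comp measurable_snd).aemeasurable).aestronglyMeasurable
  exact h.integral_prod_right'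

/-- ★ The fibre functional of a bounded jointly (a.e.-)measurable integrand, summed over the signs, is integrable against the cone measure. [folklore] -/
theorem integrable_sum_fibre {g : GnoSign L → ℍ × GnoCoord L → ℝ} (hg : ∀ ε, AEMeasurable (g ε) (coneMeasure.prod (volume : Measure (GnoCoord L))))
    {M : ℝ} (hbd : ∀ ε p, |g ε p| ≤ M) (hb : 0 ≤ b) :
    Integrable (fun a : ℍ => ∑ ε : GnoSign L, ∫ η : GnoCoord L, g ε (a, η) * Real.exp (-(b * gnoDeficit z χ a ε η)) * gnoDensity η) coneMeasure := by
  haveI := isProbabilityMeasure_coneMeasure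
  refine integrable_finsetSum _ fun ε _ => ?_
  refine Integrable.mono' (integrable_const (M * ∫ η : GnoCoord L, gnoDensity η)) (aestronglyMeasurable_fibre z χ ε (hg ε))
    (ae_of_all _ fun a => ?_)
  rw [Real.norm_eq_abs]
  exact fibre_integral_abs_le z χ ε (fun η => hbd ε (a, η)) a hb

/-- The mass functional `a ↦ Σ_ε ∫ e^{−bF̂}ρ` is cone-integrable. [folklore] -/
theorem integrable_fibre_mass (hb : 0 ≤ b) :
    Integrable (fun a : ℍ => ∑ ε : GnoSign L, ∫ η : GnoCoord L, Real.exp (-(b * gnoDeficit z χ a ε η)) * gnoDensity η) coneMeasure := by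
  have h := integrable_sum_fibre z χ (b := b) (g := fun _ _ => (1 : ℝ)) (fun _ => aemeasurable_const) (M := 1) (fun _ _ => by simp) hb
  refine h.congr (ae_of_all _ fun a => Finset.sum_congr rfl fun ε _ => integral_congr_ae (ae_of_all _ fun η => ?_))
  simp only [one_mul]

/-- The weight functional `a ↦ Σ_ε ∫ gnoW·e^{−bF̂}ρ` is cone-integrable. [folklore] -/
theorem integrable_fibre_gnoW (hb : 0 ≤ b) :
    Integrable (fun a : ℍ => ∑ ε : GnoSign L, ∫ η : GnoCoord L, gnoW η * Real.exp (-(b * gnoDeficit z χ a ε η)) * gnoDensity η) coneMeasure :=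
  integrable_sum_fibre z χ (g := fun _ p => gnoW p.2) (fun _ => (measurable_gnoW.comp measurable_snd).aemeasurable)
    (M := 4 * (3 + (Fintype.card (Fol L) : ℝ))) (fun _ p => by
      obtain ⟨h0, h1⟩ := gnoW_nonneg_le p.2; rw [abs_of_nonneg h0]; exact h1) hb

/-- The Euler functional `a ↦ Σ_ε ∫ XF̂·e^{−bF̂}ρ` is cone-integrable (a.e. bound `|XF̂| ≤ 324L⁴` off the null hub). [folklore] -/
theorem integrable_fibre_gnoXDeficit (hb : 0 ≤ b) :
    Integrable (fun a : ℍ => ∑ ε : GnoSign L, ∫ η : GnoCoord L, gnoXDeficit z χ a ε η * Real.exp (-(b * gnoDeficit z χ a ε η)) * gnoDensity η)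
      coneMeasure := by
  haveI := isProbabilityMeasure_coneMeasure
  refine integrable_finsetSum _ fun ε _ => ?_
  refine Integrable.mono' (integrable_const (324 * (L : ℝ) ^ 4 * ∫ η : GnoCoord L, gnoDensity η))
    (aestronglyMeasurable_fibre z χ ε (g := fun p => gnoXDeficit z χ p.1 ε p.2) (aemeasurable_gnoXDeficit_uncurry z χ ε)) ?_
  filter_upwards [ae_ne_zero_coneMeasure] with a ha
  rw [Real.norm_eq_abs]
  exact fibre_integral_abs_le z χ ε (fun η => abs_gnoXDeficit_le z χ ha ε η) a hb

/-- The deficit functional `a ↦ Σ_ε ∫ F̂·e^{−bF̂}ρ` is cone-integrable (`b > 0`: `F̂e^{−bF̂} ≤ b⁻¹`). [folklore] -/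
theorem integrable_fibre_gnoDeficit (hb : 0 < b) :
    Integrable (fun a : ℍ => ∑ ε : GnoSign L, ∫ η : GnoCoord L, gnoDeficit z χ a ε η * Real.exp (-(b * gnoDeficit z χ a ε η)) * gnoDensity η)
      coneMeasure := by
  haveI := isProbabilityMeasure_coneMeasure
  refine integrable_finsetSum _ fun ε _ => ?_
  have hsm : AEStronglyMeasurable (fun p : ℍ × GnoCoord L => gnoDeficit z χ p.1 ε p.2 * Real.exp (-(b * gnoDeficit z χ p.1 ε p.2)) * gnoDensity p.2)
      (coneMeasure.prod (volume : Measure (GnoCoord L))) :=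
    (((measurable_gnoDeficit_uncurry z χ ε).mul (((measurable_gnoDeficit_uncurry z χ ε).const_mul b).neg).exp).mul
      (measurable_gnoDensity.comp measurable_snd)).aestronglyMeasurable
  refine Integrable.mono' (integrable_const (b⁻¹ * ∫ η : GnoCoord L, gnoDensity η)) hsm.integral_prod_right' (ae_of_all _ fun a => ?_)
  rw [Real.norm_eq_abs, ← integral_const_mul]
  refine (abs_integral_le_integral_abs).trans (integral_mono_of_nonneg (ae_of_all _ fun η => abs_nonneg _) (integrable_gnoDensity.const_mul _)
    (ae_of_all _ fun η => ?_))
  have h0 : 0 ≤ gnoDeficit z χ a ε η * Real.exp (-(b * gnoDeficit z χ a ε η)) := mul_nonneg (gnoDeficit_nonneg z χ a ε η) (Real.exp_pos _).le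
  dsimp only
  rw [abs_mul, abs_of_nonneg h0, abs_of_pos (gnoDensity_pos η)]
  exact mul_le_mul_of_nonneg_right (mul_exp_neg_mul_le _ hb) (gnoDensity_pos η).le

end Fibre

/-! ## §3 The virial identity on the chart: signs summed, hub integrated -/

/-- ★★ **THE VIRIAL IDENTITY ON THE GNOMONIC RING CHART** (signs summed, hub integrated against the cone measure): for every `b ≥ 0`,
`b · ∫ a, Σ_ε ∫ XF̂_{a,ε}·e^{−bF̂_{a,ε}}·ρ dη ∂cone = ∫ a, Σ_ε ∫ (N − gnoW)·e^{−bF̂_{a,ε}}·ρ dη ∂cone`, `N = 7 + 3|Fol L|` (✓`virial_fibre` off the null hub `a = 0`).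
[folklore] -/
theorem virial_chart (z : Fin 3 → Bool) (χ : Site 3 L → SU2) {b : ℝ} (hb : 0 ≤ b) :
    b * ∫ a, (∑ ε : GnoSign L, ∫ η : GnoCoord L, gnoXDeficit z χ a ε η * Real.exp (-(b * gnoDeficit z χ a ε η)) * gnoDensity η) ∂coneMeasure =
      ∫ a, (∑ ε : GnoSign L, ∫ η : GnoCoord L,
        ((7 + 3 * (Fintype.card (Fol L) : ℝ)) - gnoW η) * Real.exp (-(b * gnoDeficit z χ a ε η)) * gnoDensity η) ∂coneMeasure := by
  rw [← integral_const_mul]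
  refine integral_congr_ae ?_
  filter_upwards [ae_ne_zero_coneMeasure] with a ha
  rw [Finset.mul_sum]
  exact Finset.sum_congr rfl fun ε _ => virial_fibre z χ ha ε hb

/-- ★★ **THE VIRIAL DECOMPOSITION ON THE GNOMONIC RING CHART** (`b > 0`):
`b·∫ a, Σ_ε ∫ F̂e^{−bF̂}ρ = (N/2)·∫ a, Σ_ε ∫ e^{−bF̂}ρ − ½·∫ a, Σ_ε ∫ gnoW·e^{−bF̂}ρ + b·∫ a, Σ_ε ∫ (F̂ − ½XF̂)·e^{−bF̂}ρ` (all `∂coneMeasure`),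
i.e. `b⟪F̂⟫ = α·⟪1⟫ − ½⟪W⟫ + b⟪R⟫` with `R = F̂ − ½XF̂` — memo (V3′) on the whole chart. [folklore] -/
theorem virial_chart_decomposition (z : Fin 3 → Bool) (χ : Site 3 L → SU2) {b : ℝ} (hb : 0 < b) :
    b * ∫ a, (∑ ε : GnoSign L, ∫ η : GnoCoord L, gnoDeficit z χ a ε η * Real.exp (-(b * gnoDeficit z χ a ε η)) * gnoDensity η) ∂coneMeasure =
      (7 + 3 * (Fintype.card (Fol L) : ℝ)) / 2 *
          (∫ a, (∑ ε : GnoSign L, ∫ η : GnoCoord L, Real.exp (-(b * gnoDeficit z χ a ε η)) * gnoDensity η) ∂coneMeasure)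
        - 1 / 2 * (∫ a, (∑ ε : GnoSign L, ∫ η : GnoCoord L, gnoW η * Real.exp (-(b * gnoDeficit z χ a ε η)) * gnoDensity η) ∂coneMeasure)
        + b * (∫ a, (∑ ε : GnoSign L, ∫ η : GnoCoord L,
            (gnoDeficit z χ a ε η - gnoXDeficit z χ a ε η / 2) * Real.exp (-(b * gnoDeficit z χ a ε η)) * gnoDensity η) ∂coneMeasure) := by
  have iE := integrable_fibre_mass z χ hb.le
  have iW := integrable_fibre_gnoW z χ hb.le
  have iX := integrable_fibre_gnoXDeficit z χ hb.le
  have iF := integrable_fibre_gnoDeficit z χ hb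
  -- the remainder functional, fibrewise split
  have eR : (fun a : ℍ => ∑ ε : GnoSign L, ∫ η : GnoCoord L,
        (gnoDeficit z χ a ε η - gnoXDeficit z χ a ε η / 2) * Real.exp (-(b * gnoDeficit z χ a ε η)) * gnoDensity η) =ᵐ[coneMeasure]
      fun a => (∑ ε : GnoSign L, ∫ η : GnoCoord L, gnoDeficit z χ a ε η * Real.exp (-(b * gnoDeficit z χ a ε η)) * gnoDensity η)
        - 1 / 2 * ∑ ε : GnoSign L, ∫ η : GnoCoord L, gnoXDeficit z χ a ε η * Real.exp (-(b * gnoDeficit z χ a ε η)) * gnoDensity η := by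
    filter_upwards [ae_ne_zero_coneMeasure] with a ha
    rw [Finset.mul_sum, ← Finset.sum_sub_distrib]
    refine Finset.sum_congr rfl fun ε _ => ?_
    rw [← integral_const_mul, ← integral_sub (integrable_gnoDeficit_exp_mul z χ ε a hb) ((integrable_gnoXDeficit_exp_mul z χ ε ha hb.le).const_mul _)]
    refine integral_congr_ae (ae_of_all _ fun η => ?_)
    ring
  -- the virial right-hand side, fibrewise split
  have eV : (fun a : ℍ => ∑ ε : GnoSign L, ∫ η : GnoCoord L,
        ((7 + 3 * (Fintype.card (Fol L) : ℝ)) - gnoW η) * Real.exp (-(b * gnoDeficit z χ a ε η)) * gnoDensity η) =ᵐ[coneMeasure]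
      fun a => (7 + 3 * (Fintype.card (Fol L) : ℝ)) * (∑ ε : GnoSign L, ∫ η : GnoCoord L, Real.exp (-(b * gnoDeficit z χ a ε η)) * gnoDensity η)
        - ∑ ε : GnoSign L, ∫ η : GnoCoord L, gnoW η * Real.exp (-(b * gnoDeficit z χ a ε η)) * gnoDensity η := by
    refine ae_of_all _ fun a => ?_
    dsimp only
    rw [Finset.mul_sum, ← Finset.sum_sub_distrib]
    refine Finset.sum_congr rfl fun ε _ => ?_
    rw [← integral_const_mul, ← integral_sub ((integrable_exp_gnoDeficit_mul z χ ε a hb.le).const_mul _) (integrable_gnoW_exp_mul z χ ε a hb.le)]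
    refine integral_congr_ae (ae_of_all _ fun η => ?_)
    ring
  have hV := virial_chart z χ hb.le
  rw [integral_congr_ae eV, integral_sub (iE.const_mul _) iW, integral_const_mul] at hV
  rw [integral_congr_ae eR, integral_sub iF (iX.const_mul _), integral_const_mul]
  linarith

end Summit.QuantumFields.YangMills.Theorems.SwapVirialDeficit.BlowUpRing

end
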